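import Mathlib
import Summits.Ventures.PercRepro2.Defs
import Summits.Ventures.PercRepro2.Independence
import Summits.Ventures.PercRepro2.Harris
import Summits.Ventures.PercRepro2.Graph
import Summits.Ventures.PercRepro2.Exploration
import Summits.Ventures.PercRepro2.Events
import Summits.Ventures.PercRepro2.FourFunctions
import Summits.Ventures.PercRepro2.Induced
import Summits.Ventures.PercRepro2.Frontier
import Summits.Ventures.PercRepro2.ObsIndependence
import Summits.Ventures.PercRepro2.BHK
import Summits.Ventures.PercRepro2.BHKEvents
import Summits.Ventures.PercRepro2.OrderPreservation
import Summits.Ventures.PercRepro2.BHKAvoid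
import Summits.Ventures.PercRepro2.SameClusterAvoid
import Summits.Ventures.PercRepro2.CaseOneRegime
import Summits.Ventures.PercRepro2.CaseOnePos
import Summits.Ventures.PercRepro2.CaseOneJ11
import Summits.Ventures.PercRepro2.CaseOneRV
import Summits.Ventures.PercRepro2.CaseOnePendant
import Summits.Ventures.PercRepro2.CaseOnePendantAny

/-!
# The pendant-`a₃` reduction, `(i)`-side: `(i)(v) ∧ (i-Q)(v) ⟹ (i)(a₃)` for `a₃` a leaf at `v`
(blind cell PercRepro2, p1 g13; the mirror of `CaseOnePendantAny.lean` for the `b ∈ C₁` row)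

`(i)` at a general threshold pair: **`iExprT c₀ c₁`** := `−[P(Q) E[1_{b∈C₁} Z 1_Q] − E[1_{b∈C₁} 1_Q] E[Z 1_Q]]`
with `Z = zFunT c₀ c₁`; `iExpr = iExprT D_o D` (`iExpr_eq_iExprT`), linear in `(c₀, c₁)` (`iExprT_eq`,
`iExprT_mix`); **`ZSplitIQ`** := `0 ≤ iExprT Dqo P(Q)` — `(i)` at the Q-threshold. For `a₃` a leaf at `v`
(`o, a₁, a₂, b ≠ a₃`): **`iExpr_eq_of_leaf_at`** (`iExpr(a₃) = p(e₀) · iExprT(v; D_o(a₃), D(a₃))`) and,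
with the mixture identities `Dpd_leaf_at` / `Dpdo_leaf_at`, **`zSplitI_of_leaf_at`**:
`(i)(v) ∧ (i-Q)(v) ⟹ (i)(a₃)`; hence **`jOneOne_of_leaf_at`**: `(i)(v) ∧ (i-Q)(v) ∧ (ii)(v) ∧ (ii-Q)(v) ⟹ (J1₁)(a₃)`.
Nothing beyond the reduction is claimed. -/

namespace Summit.Ventures.PercRepro2

namespace CaseOne

section ThresholdI
variable {V : Type*} {E : Type*} [Fintype E] [DecidableEq E] {R : Type*} [CommRing R]

/-- **`(i)` at a general threshold pair**, cleared:
`−[P(Q) E[1_{b∈C₁} Z 1_Q] − E[1_{b∈C₁} 1_Q] E[Z 1_Q]]`, `Z = zFunT c₀ c₁`. -/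
noncomputable def iExprT (p : E → R) (ends : E → Sym2 V) (o a₁ a₂ a₃ b : V) (c₀ c₁ : R) : R :=
  -(prob p (connEvent ends a₁ a₂)ᶜ *
      expect p (fun ω => (connEvent ends a₁ b).indicator 1 ω * zFunT ends o a₁ a₂ a₃ c₀ c₁ ω *
        ((connEvent ends a₁ a₂)ᶜ).indicator 1 ω) -
    expect p (fun ω => (connEvent ends a₁ b).indicator 1 ω * ((connEvent ends a₁ a₂)ᶜ).indicator 1 ω) *
      expect p (fun ω => zFunT ends o a₁ a₂ a₃ c₀ c₁ ω * ((connEvent ends a₁ a₂)ᶜ).indicator 1 ω))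

/-- `iExpr` is `iExprT` at the PD-threshold pair. -/
lemma iExpr_eq_iExprT (p : E → R) (ends : E → Sym2 V) (o a₁ a₂ a₃ b : V) :
    iExpr p ends o a₁ a₂ a₃ b =
      iExprT p ends o a₁ a₂ a₃ b (Dpdo p ends o a₁ a₂ a₃) (Dpd p ends a₁ a₂ a₃) :=
  rfl

/-- **`iExprT` is linear in the threshold pair**: `iExprT c₀ c₁ = −c₁ · A′ + c₀ · B′`. -/
theorem iExprT_eq (p : E → R) (ends : E → Sym2 V) (o a₁ a₂ a₃ b : V) (c₀ c₁ : R) :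
    iExprT p ends o a₁ a₂ a₃ b c₀ c₁ =
      -(c₁ * (prob p (connEvent ends a₁ a₂)ᶜ *
          prob p (connEvent ends a₁ b ∩ connEvent ends a₁ a₃ ∩ connEvent ends a₂ o ∩
            (connEvent ends a₁ a₂)ᶜ) -
        prob p (connEvent ends a₁ b ∩ (connEvent ends a₁ a₂)ᶜ) *
          prob p (connEvent ends a₁ a₃ ∩ connEvent ends a₂ o ∩ (connEvent ends a₁ a₂)ᶜ))) +
      c₀ * (prob p (connEvent ends a₁ a₂)ᶜ *
          prob p (connEvent ends a₁ b ∩ connEvent ends a₁ a₃ ∩ (connEvent ends a₁ a₂)ᶜ) -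
        prob p (connEvent ends a₁ b ∩ (connEvent ends a₁ a₂)ᶜ) *
          prob p (connEvent ends a₁ a₃ ∩ (connEvent ends a₁ a₂)ᶜ)) := by
  unfold iExprT zFunT
  have e1 : expect p (fun ω => (connEvent ends a₁ b).indicator (1 : Config E → R) ω *
      ((connEvent ends a₁ a₃).indicator 1 ω *
        (c₁ * (connEvent ends a₂ o).indicator 1 ω - c₀)) *
      ((connEvent ends a₁ a₂)ᶜ).indicator 1 ω) =
      expect p (fun ω => ((connEvent ends a₁ b).indicator (1 : Config E → R) ω *
        (connEvent ends a₁ a₃).indicator 1 ω) *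
        (c₁ * (connEvent ends a₂ o).indicator 1 ω - c₀) *
        ((connEvent ends a₁ a₂)ᶜ).indicator 1 ω) := by
    congr 1
    funext ω
    ring
  rw [e1, expect_mul_affine, expect_mul_affine]
  simp only [expect_ind4, expect_ind3, expect_ind2]
  ring

/-- `iExprT` at a mixture of threshold pairs is the mixture of the `iExprT`s. -/
lemma iExprT_mix (p : E → R) (ends : E → Sym2 V) (o a₁ a₂ a₃ b : V) (t c₀ c₁ c₀' c₁' : R) :
    iExprT p ends o a₁ a₂ a₃ b ((1 - t) * c₀ + t * c₀') ((1 - t) * c₁ + t * c₁') =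
      (1 - t) * iExprT p ends o a₁ a₂ a₃ b c₀ c₁ + t * iExprT p ends o a₁ a₂ a₃ b c₀' c₁' := by
  rw [iExprT_eq, iExprT_eq, iExprT_eq]
  ring

end ThresholdI

section ThresholdIProp
variable {V : Type*} {E : Type*} [Fintype E] [DecidableEq E] {R : Type*} [CommRing R] [LinearOrder R]

/-- **`(i-Q)`**: `(i)` at the Q-threshold pair `(P(Q, o ∈ U), P(Q))`. A definition only. -/
def ZSplitIQ (p : E → R) (ends : E → Sym2 V) (o a₁ a₂ a₃ b : V) : Prop :=
  0 ≤ iExprT p ends o a₁ a₂ a₃ b (Dqo p ends o a₁ a₂) (prob p (connEvent ends a₁ a₂)ᶜ)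

end ThresholdIProp

section ReductionI
variable {V : Type*} {E : Type*} [Fintype E] [DecidableEq E] {R : Type*} [CommRing R]
variable {ends : E → Sym2 V} {v a₃ : V} {e₀ : E}

/-- **`iExpr(a₃) = p(e₀) · iExprT(v; D_o(a₃), D(a₃))`** when `a₃` is a leaf at `v`
(`o, a₁, a₂, b ≠ a₃`). -/
theorem iExpr_eq_of_leaf_at (p : E → R) (hl : IsLeafAt ends v a₃ e₀) (o a₁ a₂ b : V)
    (ho : o ≠ a₃) (h1 : a₁ ≠ a₃) (h2 : a₂ ≠ a₃) (hb : b ≠ a₃) :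
    iExpr p ends o a₁ a₂ a₃ b = p e₀ *
      iExprT p ends o a₁ a₂ v b (Dpdo p ends o a₁ a₂ a₃) (Dpd p ends a₁ a₂ a₃) := by
  unfold iExpr iExprT zFun zFunT
  set D := Dpd p ends a₁ a₂ a₃
  set Do := Dpdo p ends o a₁ a₂ a₃
  simp only [indicator_leaf_at hl h1]
  have hv : v ≠ a₃ := hl.ne
  have e1 : expect p (fun ω => (connEvent ends a₁ b).indicator (1 : Config E → R) ω *
      ((openEdge e₀).indicator 1 ω * (connEvent ends a₁ v).indicator 1 ω *
        (D * (connEvent ends a₂ o).indicator 1 ω - Do)) *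
      ((connEvent ends a₁ a₂)ᶜ).indicator 1 ω) =
      p e₀ * expect p (fun ω => (connEvent ends a₁ b).indicator (1 : Config E → R) ω *
        ((connEvent ends a₁ v).indicator 1 ω * (D * (connEvent ends a₂ o).indicator 1 ω - Do)) *
        ((connEvent ends a₁ a₂)ᶜ).indicator 1 ω) := by
    have : (fun ω => (connEvent ends a₁ b).indicator (1 : Config E → R) ω *
        ((openEdge e₀).indicator 1 ω * (connEvent ends a₁ v).indicator 1 ω *
          (D * (connEvent ends a₂ o).indicator 1 ω - Do)) *
        ((connEvent ends a₁ a₂)ᶜ).indicator 1 ω) =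
        fun ω => ((connEvent ends a₁ b).indicator (1 : Config E → R) ω *
          ((connEvent ends a₁ v).indicator 1 ω * (D * (connEvent ends a₂ o).indicator 1 ω - Do)) *
          ((connEvent ends a₁ a₂)ᶜ).indicator 1 ω) * (openEdge e₀).indicator 1 ω := by
      funext ω; ring
    rw [this, expect_mul_openEdge_of_ignore p e₀ _ (fun ω c => by
      simp only [Set.indicator_compl, Pi.one_apply, Pi.sub_apply]
      rw [connEvent_indicator_update_of_leaf hl ω c h1 hb,
        connEvent_indicator_update_of_leaf hl ω c h1 hv,
        connEvent_indicator_update_of_leaf hl ω c h2 ho,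
        connEvent_indicator_update_of_leaf hl ω c h1 h2])]
  have e2 : expect p (fun ω => (openEdge e₀).indicator (1 : Config E → R) ω *
      (connEvent ends a₁ v).indicator 1 ω * (D * (connEvent ends a₂ o).indicator 1 ω - Do) *
      ((connEvent ends a₁ a₂)ᶜ).indicator 1 ω) =
      p e₀ * expect p (fun ω => (connEvent ends a₁ v).indicator (1 : Config E → R) ω *
        (D * (connEvent ends a₂ o).indicator 1 ω - Do) * ((connEvent ends a₁ a₂)ᶜ).indicator 1 ω) := by
    have : (fun ω => (openEdge e₀).indicator (1 : Config E → R) ω *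
        (connEvent ends a₁ v).indicator 1 ω * (D * (connEvent ends a₂ o).indicator 1 ω - Do) *
        ((connEvent ends a₁ a₂)ᶜ).indicator 1 ω) =
        fun ω => ((connEvent ends a₁ v).indicator (1 : Config E → R) ω *
          (D * (connEvent ends a₂ o).indicator 1 ω - Do) *
          ((connEvent ends a₁ a₂)ᶜ).indicator 1 ω) * (openEdge e₀).indicator 1 ω := by
      funext ω; ring
    rw [this, expect_mul_openEdge_of_ignore p e₀ _ (fun ω c => by
      simp only [Set.indicator_compl, Pi.one_apply, Pi.sub_apply]
      rw [connEvent_indicator_update_of_leaf hl ω c h1 hv,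
        connEvent_indicator_update_of_leaf hl ω c h2 ho,
        connEvent_indicator_update_of_leaf hl ω c h1 h2])]
  rw [e1, e2]
  ring

end ReductionI

section TheoremI
variable {V : Type*} {E : Type*} [Fintype E] [DecidableEq E] {R : Type*} [CommRing R]
  [LinearOrder R] [IsStrictOrderedRing R]
variable {ends : E → Sym2 V} {v a₃ : V} {e₀ : E}

/-- **The pendant-`a₃` reduction for `(i)`**: `(i)(v) ∧ (i-Q)(v) ⟹ (i)(a₃)` when `a₃` is a leaf at `v`
(`o, a₁, a₂, b ≠ a₃`). -/
theorem zSplitI_of_leaf_at (p : E → R) (hp : IsProbVec p) (hl : IsLeafAt ends v a₃ e₀)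
    (o a₁ a₂ b : V) (ho : o ≠ a₃) (h1 : a₁ ≠ a₃) (h2 : a₂ ≠ a₃) (hb : b ≠ a₃)
    (hPD : ZSplitI p ends o a₁ a₂ v b) (hQ : ZSplitIQ p ends o a₁ a₂ v b) :
    ZSplitI p ends o a₁ a₂ a₃ b := by
  unfold ZSplitI at hPD ⊢
  unfold ZSplitIQ at hQ
  rw [iExpr_eq_iExprT] at hPD
  rw [iExpr_eq_of_leaf_at p hl o a₁ a₂ b ho h1 h2 hb, Dpd_leaf_at p hl a₁ a₂ h1 h2,
    Dpdo_leaf_at p hl o a₁ a₂ ho h1 h2, iExprT_mix]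
  have hp0 : 0 ≤ p e₀ := hp.nonneg e₀
  have hp1 : 0 ≤ 1 - p e₀ := by linarith [hp.le_one e₀]
  exact mul_nonneg hp0 (add_nonneg (mul_nonneg hp1 hQ) (mul_nonneg hp0 hPD))

/-- **The pendant-`a₃` reduction for `(J1₁)`**: the four rows at `v` give `(J1₁)` at `a₃`. -/
theorem jOneOne_of_leaf_at (p : E → R) (hp : IsProbVec p) (hl : IsLeafAt ends v a₃ e₀)
    (o a₁ a₂ b : V) (ho : o ≠ a₃) (h1 : a₁ ≠ a₃) (h2 : a₂ ≠ a₃) (hb : b ≠ a₃)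
    (hi : ZSplitI p ends o a₁ a₂ v b) (hiQ : ZSplitIQ p ends o a₁ a₂ v b)
    (hii : ZSplitII p ends o a₁ a₂ v b) (hiiQ : ZSplitIIQ p ends o a₁ a₂ v b) :
    JOneOne p ends o a₁ a₂ a₃ b :=
  jOneOne_of_i_of_ii p ends o a₁ a₂ a₃ b (zSplitI_of_leaf_at p hp hl o a₁ a₂ b ho h1 h2 hb hi hiQ)
    (zSplitII_of_leaf_at p hp hl o a₁ a₂ b ho h1 h2 hb hii hiiQ)

end TheoremI

end CaseOne

end Summit.Ventures.PercRepro2
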